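import Summits.Langlands.Langlands.Theses.DyadicOddResidue
import Summits.Langlands.Langlands.Theorems.DyadicOddResidueAssembly

/-!
# LADDER LINE `OddPrimesAllWt` on the top `DyadicOddResidue.Assembly` (crux stmt-Langlands-18746)
(G4 `ladder-down`, planner `fwd-ladder-Langlands-18746`, 2026-08-17; card `Lines/OddPrimesAllWt_DyadicOddResidue.md`,
witness `Lines/OddPrimesAllWt_DyadicOddResidue_special.lean`, ladder `LADDER-Assembly_DyadicOddResidue.md`)

TOP  C := `Assembly = DyadicEisensteinFM → DyadicDihedralFM → Langlands` — `≡ Langlands` given K1, K2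
(`Theorems.dyadicOddResidue_assembly_iff_langlands`, landed) and `≡ SectorComplement` given the four cells
(`Theorems.dyadicOddResidue_assembly_iff_sectorComplement`).  C is the summit in the route's language and is NOT filed.

GRADATION (C's own language).  The parent target `OddRegularReciprocityQ` = clause (B), a.e. form, on the sector
`n = 2, F = ℚ, ρ odd`, with the WEIGHT clause `HT_τ(ρ|Γ_{ℚ_ℓ}).Nodup`.  Parameter: the weight-admissibility predicate
`adm : ℕ → Multiset ℤ → Prop` (may depend on `ℓ`) in place of `Nodup` ⇒ family `OddReciprocityQ adm`, and in cell
language `Rung adm := K1 → K2 → S1 → S2 → OddReciprocityQ adm` (antitone in `adm`).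
* θ₀ = `regularWt` (`m.Nodup`): FLOOR, PROVED (`rung_regularWt`, the trichotomy at `ℓ`; `OddReciprocityQ regularWt`
  is `OddRegularReciprocityQ` by `Iff.rfl`) — special file.
* θ₁ = `oddPrimesAllWt` (`ℓ = 2 → m.Nodup`): NEXT RUNG = `stub_rung` — at every ODD `ℓ` the regularity hypothesis is
  dropped: an odd irreducible a.e.-unramified `ρ : Γ_ℚ → GL₂(ℚ̄_ℓ)`, de Rham at `ℓ` with a REPEATED labelled weight
  `(w, w)` (⟺ `ρ ⊗ ε^w` potentially unramified at `ℓ`, Sen), is Satake–Frobenius compatible a.e. with an L-algebraic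
  cuspidal `π` of `GL₂(𝔸_ℚ)` — "weight-one / Artin-weight Fontaine–Mazur over `ℚ` at odd `ℓ`", for EVERY residual
  image.  Printed inside θ₁: `ρ̄|G_{ℚ(ζ_ℓ)}` irreducible ∧ `(ρ̄|G_{ℚ_ℓ})^ss` generic (Pan, Forum Math. Pi 10 (2022)
  Thm 1.0.5 = Cor 6.4.9 = Pilloni–Stroh, Astérisque 382 (2016); Buzzard–Taylor 1999, Calegari–Geraghty 2018 in the
  unramified-at-`ℓ` case); finite-image `ρ` (Khare–Wintenberger 2009 Thm 10.1(ii), tree fact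
  `khareWintenberger_weightOne_of_isOdd`).  OPEN inside θ₁ (the located stop, Pan loc. cit. Rmk 6.4.10, p. 53):
  `ρ̄` reducible, or irreducible with `ρ̄|G_{ℚ(ζ_ℓ)}` reducible, or `ℓ = 3` locally `η ⊕ ηω` — [Pan19] gives only
  pro-modularity of `ρ|G_F` over a solvable totally real `F/ℚ` with `ℓ` split, and the weight-one classicality of
  pro-modular representations (Pan Thm 6.4.7, hypothesis-free over `ℚ`) is not known over such `F`.
* θ₂ = `allWt` (`⊤`): also at `ℓ = 2` — `stub_dyadicAllWt : Rung θ₁ → Rung θ₂` (dyadic weight `(w,w)`: pro-modularity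
  at `2` is the weight-blind core of the route's own K1/K2; classicality = Pan Thm 6.4.7, stated for every `p`).
GAP AFTER θ₂ (frame, summit-scale, declared): the junction one rung up `stub_junctionAllWt : OddReciprocityQ ⊤ → Langlands`
(WEAKER than the route's junction `SectorComplement`, item 18745: `sectorComplementAllWt_of_sectorComplement`), and the
two printed cells `stub_cellOddPrimes = OddPrimesRegularFM` (item 18743), `stub_cellDyadicNonsolvable =
DyadicNonsolvableFM` (item 18744), which `Assembly` omits from its hypotheses.
COMPOSITION `Assembly_of : stub_rung → stub_dyadicAllWt → stub_cellOddPrimes → stub_cellDyadicNonsolvable →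
stub_junctionAllWt → Assembly` (kernel-checked, no sorry; the five `stub_*` are the ONLY sorries), and to S by the landed
top equivalence BY NAME (`langlands_of_stubs`).  ON-PATH: `rung_of_langlands : Langlands → Rung adm` for every `adm`
(proved; oddness and the weight clause unused) — rungs are consequences of S pinned below to a PROVED floor (F3/F4).
-/

noncomputable section

set_option linter.dupNamespace false

namespace Summit.Langlands.Langlands.Cruxes.Assembly.OddPrimesAllWt

open scoped BigOperators Topology Manifold Classical MeasureTheory ProbabilityTheory Matrix InnerProductSpace ComplexConjugate ContinuousMap
open Filter Set Function TopologicalSpace MeasureTheory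
open Summit.Langlands.Langlands.Theses.DyadicOddResidue

/-! ## The graded family (rung_decl) -/

/-- The parent target `OddRegularReciprocityQ` with its weight clause `HT_τ(…).Nodup` replaced by the parameter
`adm ℓ HT_τ(…)`; everything else VERBATIM. -/
def OddReciprocityQ (adm : ℕ → Multiset ℤ → Prop) : Prop :=
  ∀ (ℓ : ℕ) [Fact ℓ.Prime] (ρ : Literature.NumberTheory.GaloisRepresentations.FramedGaloisRep ℚ (PadicAlgCl ℓ) 2), ρ.toGaloisRep.IsIrreducible → ρ.IsOdd → (∀ᶠ v : IsDedekindDomain.HeightOneSpectrum (NumberField.RingOfIntegers ℚ) in Filter.cofinite, ρ.IsUnramifiedAt v) → (∀ (v : IsDedekindDomain.HeightOneSpectrum (NumberField.RingOfIntegers ℚ)) (hv : ((ℓ : ℕ) : NumberField.RingOfIntegers ℚ) ∈ v.asIdeal), (Literature.NumberTheory.PAdicHodge.fontainePstAdicCompletion v ℓ hv).IsDeRhamFramed (ρ.toLocal v) ∧ ∀ τ : v.adicCompletion ℚ →+* PadicAlgCl ℓ, Continuous τ → adm ℓ (ρ.labelledHodgeTateWeightsAt v (Literature.NumberTheory.PAdicHodge.fontainePstAdicCompletion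 v ℓ hv).algebra (Literature.NumberTheory.PAdicHodge.fontainePstAdicCompletion v ℓ hv).𝔅 τ)) → ∀ (hcpt : Literature.NumberTheory.Automorphic.isCompact_glFiniteIntegralLevel 2 ℚ) (ι : PadicAlgCl ℓ ≃+* ℂ), ∃ π : Literature.NumberTheory.Automorphic.CuspidalAutomorphicRepData 2 ℚ hcpt, π.1.IsLAlgebraic ∧ ∀ᶠ v : IsDedekindDomain.HeightOneSpectrum (NumberField.RingOfIntegers ℚ) in Filter.cofinite, Summit.Langlands.SatakeFrobCompatibleAt ι π.1 ρ v

/-- θ₀ (floor): multiplicity-free labelled Hodge–Tate weights at every `ℓ`. -/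
def regularWt : ℕ → Multiset ℤ → Prop := fun _ m => m.Nodup

/-- θ₁ (next rung): no weight condition at odd `ℓ`; regular at `ℓ = 2`. -/
def oddPrimesAllWt : ℕ → Multiset ℤ → Prop := fun ℓ m => ℓ = 2 → m.Nodup

/-- θ₂ (top of the weight parameter): no weight condition. -/
def allWt : ℕ → Multiset ℤ → Prop := fun _ _ => True

/-- The rung in C's cell language (K1, K2 = the route's open cruxes; S1, S2 = its printed supports). -/
def Rung (adm : ℕ → Multiset ℤ → Prop) : Prop :=
  DyadicEisensteinFM → DyadicDihedralFM → OddPrimesRegularFM → DyadicNonsolvableFM → OddReciprocityQ adm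

/-- The junction one rung up: reciprocity for `GL_n` over number fields GRANTED clause (B), a.e. form, on the whole
odd sector of `GL₂/ℚ` (all weights, all `ℓ`).  Frame leaf = `gap_after`; weaker than the route's `SectorComplement`. -/
def SectorComplementAllWt : Prop := OddReciprocityQ allWt → _root_.Langlands

/-! ## Proved bookkeeping (no sorry): floor identity, monotonicity, on-path, comparison with the route's junction -/

theorem oddReciprocityQ_regularWt_iff : OddReciprocityQ regularWt ↔ OddRegularReciprocityQ := Iff.rfl

theorem oddReciprocityQ_anti {adm adm' : ℕ → Multiset ℤ → Prop} (h : ∀ ℓ m, adm ℓ m → adm' ℓ m) :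
    OddReciprocityQ adm' → OddReciprocityQ adm := by
  intro hY ℓ _ ρ hirr hodd hunr hdR hcpt ι
  exact hY ℓ ρ hirr hodd hunr (fun v hv => ⟨(hdR v hv).1, fun τ hτ => h ℓ _ ((hdR v hv).2 τ hτ)⟩) hcpt ι

theorem rung_anti {adm adm' : ℕ → Multiset ℤ → Prop} (h : ∀ ℓ m, adm ℓ m → adm' ℓ m) : Rung adm' → Rung adm :=
  fun hR k₁ k₂ s₁ s₂ => oddReciprocityQ_anti h (hR k₁ k₂ s₁ s₂)

theorem rung_regularWt_of_oddPrimesAllWt : Rung oddPrimesAllWt → Rung regularWt := rung_anti fun _ _ h _ => h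
theorem rung_oddPrimesAllWt_of_allWt : Rung allWt → Rung oddPrimesAllWt := rung_anti fun _ _ _ => trivial

/-- ON-PATH (F4): the summit gives every member of the family (oddness and the weight clause are not used). -/
theorem oddReciprocityQ_of_langlands (adm : ℕ → Multiset ℤ → Prop) (hL : _root_.Langlands) : OddReciprocityQ adm := by
  intro ℓ _ ρ hirr _hodd hur hdR hcpt ι
  obtain ⟨⟨R⟩, h⟩ := hL ℚ
  have hB : Summit.Langlands.GaloisToAutomorphic 2 R hcpt := (h R 2 two_pos hcpt).2
  have hgeo : Summit.Langlands.IsGeometricFramed R ρ := ⟨hur, fun v hv ↦ (hdR v hv).1⟩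
  obtain ⟨π, hLalg, hcorr⟩ := hB ℓ ι ρ hirr hgeo
  exact ⟨π, hLalg, hcorr.1⟩

theorem rung_of_langlands (adm : ℕ → Multiset ℤ → Prop) (hL : _root_.Langlands) : Rung adm :=
  fun _ _ _ _ => oddReciprocityQ_of_langlands adm hL

/-- The gap junction is implied by the route's junction (item stmt-Langlands-18745). -/
theorem sectorComplementAllWt_of_sectorComplement : SectorComplement → SectorComplementAllWt :=
  fun hC hY => hC ((oddReciprocityQ_regularWt_iff).1 (oddReciprocityQ_anti (fun _ _ _ => trivial) hY))

/-! ## The stubs (the ONLY sorries of this file) -/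

/-- **stub 1 — NEXT RUNG θ₁ (crux #1, load-bearing): weight-one Fontaine–Mazur over `ℚ` at every ODD `ℓ`, every
residual image, granted the route's four regular cells.**  Printed inside: TW-generic residual image (Pan 2022
Thm 1.0.5 = Pilloni–Stroh 2016; Buzzard–Taylor 1999; Calegari–Geraghty 2018), finite image (Khare–Wintenberger 2009
Thm 10.1(ii)).  Attack on the open cells (`ρ̄` reducible / `ρ̄|G_{ℚ(ζ_ℓ)}` reducible / `ℓ = 3` local exception):
[Pan19] potential pro-modularity over a solvable totally real `F` with `ℓ` split (printed) + WEIGHT-ONE CLASSICALITY OF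
PRO-MODULAR REPRESENTATIONS OVER SUCH `F` (the first lemma; Pan Rmk 6.4.10 expects it; the regular analogue over `F` is
arXiv:2605.18426, 2026) + solvable descent (Skinner–Wiles) + the newform → `(π, Satake)` dictionary shared with S1;
alternative over `ℚ`: big `R^ps = 𝕋` for reducible `ρ̄`, `ℓ ≥ 5` (X. Zhang, arXiv:2512.21249) + Pan Thm 6.4.7.
Why it might fail: mathematically nobody expects an infinite-image odd `ρ` potentially unramified at `ℓ`; the risks are
the typed clauses (pinned de Rham datum, `SatakeFrobCompatibleAt` normalisation — the SAME clauses as the parent target)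
and that the open cells need a Hilbert-modular weight-one classicality that does not yet exist.
[cite: Pan2022LocallyAnalytic, Thm. 1.0.5, Thm. 6.4.7, Rmk. 6.4.10] [cite: KhareWintenberger2009, Thm. 10.1(ii)] -/
theorem stub_rung : Rung oddPrimesAllWt := by
  sorry

/-- **stub 2 — the increment θ₁ → θ₂ (gap rung): dyadic weight `(w,w)`.**  Granted θ₁ (and, inside it, the four
regular cells), drop the weight condition at `ℓ = 2` as well: pro-modularity at `2` of an odd irreducible `ρ` (the
weight-blind core of the route's own cruxes K1/K2 and of Kisin's 2-adic Serre weight 2 lifting) + Pan's weight-one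
classicality Thm 6.4.7, stated for every prime (Cor 6.3.6 via Colmez–Dospinescu–Paškūnas + Paškūnas–Tung at `p = 2`).
Why it might fail: Emerton/Pan pro-modularity (Thm 6.4.8) is `p > 2` only; at `2` oddness is invisible mod `2` and
`ω ≡ 1`.  [cite: Pan2022LocallyAnalytic, Thm. 6.4.7–6.4.8] [cite: PaskunasTung2021, Thm. 7.1] -/
theorem stub_dyadicAllWt : Rung oddPrimesAllWt → Rung allWt := by
  sorry

/-- **stub 3 — printed cell S1 = route item stmt-Langlands-18743 `OddPrimesRegularFM` BY NAME** (X. Zhang,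
arXiv:2412.06812 Thm 1.0.2: Fontaine–Mazur for odd regular `ρ` at every odd `p`, all residual images; formalisation
debt, shared with the route's `closes`).  [cite: XZhang2024FontaineMazurP3, Thm. 1.0.2] -/
theorem stub_cellOddPrimes : OddPrimesRegularFM := by
  sorry

/-- **stub 4 — printed cell S2 = route item stmt-Langlands-18744 `DyadicNonsolvableFM` BY NAME** (Tung 2020 Thm 1 +
Khare–Wintenberger; formalisation debt, shared with the route's `closes`).  [cite: Tung2020, Thm. 1] -/
theorem stub_cellDyadicNonsolvable : DyadicNonsolvableFM := by
  sorry

/-- **stub 5 — the junction one rung up (`gap_after`, summit-scale FRAME leaf, declared, not attacked here):**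
reciprocity for `GL_n` over all number fields (both directions, all places, the summit's reciprocity data) GRANTED
clause (B), a.e. form, on the whole odd sector of `GL₂/ℚ`.  Strictly weaker than the route's junction
`SectorComplement` (item stmt-Langlands-18745, HOLD): `sectorComplementAllWt_of_sectorComplement`.  It is a consequence
of S (`fun h _ => h`) and does not give S or C alone.  [cite: BuzzardGeeLMS2014, Conj. 3.2.1, 3.2.2] -/
theorem stub_junctionAllWt : SectorComplementAllWt := by
  sorry

namespace _Goal

/-- mirror of `stub_rung`. -/
def stub_rung : Prop :=
  type_of% @Summit.Langlands.Langlands.Cruxes.Assembly.OddPrimesAllWt.stub_rung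
/-- mirror of `stub_dyadicAllWt`. -/
def stub_dyadicAllWt : Prop :=
  type_of% @Summit.Langlands.Langlands.Cruxes.Assembly.OddPrimesAllWt.stub_dyadicAllWt
/-- mirror of `stub_cellOddPrimes`. -/
def stub_cellOddPrimes : Prop :=
  type_of% @Summit.Langlands.Langlands.Cruxes.Assembly.OddPrimesAllWt.stub_cellOddPrimes
/-- mirror of `stub_cellDyadicNonsolvable`. -/
def stub_cellDyadicNonsolvable : Prop :=
  type_of% @Summit.Langlands.Langlands.Cruxes.Assembly.OddPrimesAllWt.stub_cellDyadicNonsolvable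
/-- mirror of `stub_junctionAllWt`. -/
def stub_junctionAllWt : Prop :=
  type_of% @Summit.Langlands.Langlands.Cruxes.Assembly.OddPrimesAllWt.stub_junctionAllWt

end _Goal

/-- **THE LADDER TO C, kernel-checked**: next rung θ₁, increment to θ₂, the two printed cells, the junction ⇒
`Assembly` (concluded BY NAME: the route decl `Summit.Langlands.Langlands.Theses.DyadicOddResidue.Assembly`). -/
theorem Assembly_of (h1 : _Goal.stub_rung) (h2 : _Goal.stub_dyadicAllWt) (h3 : _Goal.stub_cellOddPrimes)
    (h4 : _Goal.stub_cellDyadicNonsolvable) (h5 : _Goal.stub_junctionAllWt) :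
    Summit.Langlands.Langlands.Theses.DyadicOddResidue.Assembly := by
  dsimp only [_Goal.stub_rung, _Goal.stub_dyadicAllWt, _Goal.stub_cellOddPrimes, _Goal.stub_cellDyadicNonsolvable,
    _Goal.stub_junctionAllWt] at h1 h2 h3 h4 h5
  exact fun k₁ k₂ => h5 (h2 h1 k₁ k₂ h3 h4)

/-- … and to the summit through the LANDED top equivalence, by name. -/
theorem langlands_of_stubs (h1 : _Goal.stub_rung) (h2 : _Goal.stub_dyadicAllWt) (h3 : _Goal.stub_cellOddPrimes)
    (h4 : _Goal.stub_cellDyadicNonsolvable) (h5 : _Goal.stub_junctionAllWt)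
    (k₁ : DyadicEisensteinFM) (k₂ : DyadicDihedralFM) : _root_.Langlands :=
  (Summit.Langlands.Langlands.Theorems.dyadicOddResidue_assembly_iff_langlands k₁ k₂).1 (Assembly_of h1 h2 h3 h4 h5)

/-- by-name sanity check: the composition with the stubs plugged in. -/
example : Summit.Langlands.Langlands.Theses.DyadicOddResidue.Assembly :=
  Assembly_of stub_rung stub_dyadicAllWt stub_cellOddPrimes stub_cellDyadicNonsolvable stub_junctionAllWt

end Summit.Langlands.Langlands.Cruxes.Assembly.OddPrimesAllWt

end
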